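import Literature.Analysis.Calculus.WhitneyConvexWeights
import Mathlib.Analysis.Calculus.ContDiff.Bounds
import Mathlib.Analysis.Calculus.IteratedDeriv.Lemmas
import Mathlib.Analysis.Calculus.Taylor
import Mathlib.Analysis.Convex.Topology
import Mathlib.LinearAlgebra.AffineSpace.AffineMap
import Mathlib.Topology.UniformSpace.Compact
import HarnessLib

/-!
# Dilation–extrapolation approximants on a convex body: calculus and the two estimates

Support file 3/7 for the planned proof of `Literature.Analysis.Calculus.WhitneyExtensionConvex`
(`WhitneyExtension.lean`; Whitney (1934), Thm. I, on closed convex sets with nonempty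
interior).  Let `K` be a convex set containing the ball `closedBall c r`, and `f` a function
`C^∞` on `K` in the within sense, with jet `p_γ = iteratedFDerivWithin ℝ γ f K`.  The
**dilation–extrapolation approximant** of order `n` at scale `t` is

`approx f c n t x = ∑_{j ≤ n} w_j • f (c + μ_j (x - c))`, `μ_j = 1 - 2^j t`,

with the extrapolation weights `w_j = weight (n+1) j` of `WhitneyConvexWeights.lean` (Lagrange
basis values at `0` for the nodes `2^j`, reproducing polynomials of degree `≤ n`).  Points
outside `K` but close to it are dilated *into the interior* of `K` (`dil_mem_interior`: the
ball of radius `(1 - μ) r` about the dilate of a point of `K` lies in `K`), where `f` is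
genuinely smooth, so `approx` is smooth near `K` off `K`; and since a dilation is affine
(`dil c μ = AffineMap.homothety c μ`, `dil_eq_homothety`), its derivatives are explicit:
`Dᵞ (f ∘ dil_μ)(x) = μᵞ • Dᵞ f (dil_μ x)` (`iteratedFDeriv_comp_dil`, from Mathlib's
translation invariance of `iteratedFDeriv` and `ContinuousLinearMap.iteratedFDerivWithin_comp_right`).
This replaces, for convex bodies, the Taylor polynomials at nearest points of Whitney's
construction (Whitney (1934), §11; Stein (1970), Ch. VI §2.2) by dilates — avoiding Taylor
polynomials in several variables altogether — in the spirit of Seeley's reflection operator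
(Seeley (1964)) with dilation toward an interior point in place of reflection across a
hyperplane.  Contents:

* `dil`, its geometry in a convex body (`ball_dil_subset`, `dil_mem_interior`), the
  approximants `approx` with their domain of smoothness `goodSet` (`contDiffAt_approx`) and
  the **derivative formula** `Dᵞ (approx f c n t) x = ∑_j (w_j μ_jᵞ) • Dᵞ f (dil_{μ_j} x)`
  (`iteratedFDeriv_approx`);
* the jet `p_γ` within `K` (`contDiffOn_jet`, bounds on a compact body) and the **jet along
  the ray** `lineJet f K c x γ : μ ↦ μᵞ • p_γ (dil c μ x)`, smooth wherever the dilate is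
  interior (`contDiffOn_lineJet`), through which `Dᵞ (approx f c n t) x = ∑_j w_j • lineJet … μ_j`
  (`iteratedFDeriv_approx_eq_sum_lineJet`), with `μ`-derivatives bounded uniformly in `x` over
  bounded sets (`exists_bound_iteratedFDeriv_lineJet`: Leibniz rule and chain rule through the
  affine ray);
* `Literature.Analysis.Calculus.WhitneyConvex.exists_extrapolation_bound` — the **extrapolation
  estimate**: for scales `0 < t' < t` with the segment of ratios `[1 - 2ⁿ t, 1 - t']` dilating
  `x` into the interior, `‖Dᵞ (approx f c n t) x - Dᵞ (approx f c n t') x‖ ≤ C tⁿ⁺¹`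
  (Taylor's theorem in the one variable `μ`, Mathlib's `taylor_mean_remainder_bound`, and
  polynomial reproduction `sum_weight_smul_taylorWithinEval`), and the same at one scale for
  consecutive orders (`exists_extrapolation_bound_succ`);
* `Literature.Analysis.Calculus.WhitneyConvex.exists_boundary_bound` — the **boundary
  estimate**: `‖Dᵞ (approx f c n t) x - p_γ (b)‖ ≤ ε` for `b ∈ K` once `t` and `‖x - b‖` are
  small (uniform continuity of `p_γ` on the compact `K`, `∑ w_j = 1`, `1 - μᵞ ≤ γ (1 - μ)`).

## References

* H. Whitney, *Analytic extensions of differentiable functions defined in closed sets*, Trans.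
  Amer. Math. Soc. 36 (1934), 63–89, §§11–12. [Whitney1934]
* R. T. Seeley, *Extension of `C^∞` functions defined in a half space*, Proc. Amer. Math. Soc.
  15 (1964), 625–626. [Seeley1964]
* E. M. Stein, *Singular Integrals and Differentiability Properties of Functions* (1970),
  Ch. VI, §2.2. [SteinSingularIntegrals1970]
-/


open Set Metric Filter Function Finset
open scoped ContDiff Topology Nat

noncomputable section

namespace Literature.Analysis.Calculus.WhitneyConvex

variable {E : Type*} [NormedAddCommGroup E] [NormedSpace ℝ E]
variable {F : Type*} [NormedAddCommGroup F] [NormedSpace ℝ F]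

/-! ### Dilations toward a point -/

/-- The dilation `dil c μ x = c + μ (x - c)` with centre `c` and ratio `μ`. [folklore] -/
def dil (c : E) (μ : ℝ) (x : E) : E := c + μ • (x - c)

/-- Unfolding the dilation. [folklore] -/
theorem dil_apply (c : E) (μ : ℝ) (x : E) : dil c μ x = c + μ • (x - c) := rfl

/-- The dilation is Mathlib's homothety `AffineMap.homothety c μ` (kept as a light wrapper with
the argument order of the construction). [folklore] -/
theorem dil_eq_homothety (c : E) (μ : ℝ) (x : E) : dil c μ x = AffineMap.homothety c μ x := by
  simp [dil, AffineMap.homothety_apply, vsub_eq_sub, vadd_eq_add, add_comm]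

/-- `dil c 1 = id`. [folklore] -/
@[simp] theorem dil_one (c x : E) : dil c 1 x = x := by simp [dil]

/-- `dil c 0 = c`. [folklore] -/
@[simp] theorem dil_zero (c x : E) : dil c 0 x = c := by simp [dil]

/-- The centre is fixed. [folklore] -/
@[simp] theorem dil_self (c : E) (μ : ℝ) : dil c μ c = c := by simp [dil]

/-- Dilations contract differences by the ratio: `dil c μ x - dil c μ y = μ (x - y)`. [folklore] -/
theorem dil_sub_dil (c : E) (μ : ℝ) (x y : E) : dil c μ x - dil c μ y = μ • (x - y) := by
  simp only [dil, smul_sub]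
  abel

/-- The displacement of a point under a dilation: `dil c μ x - x = (1 - μ) (c - x)`. [folklore] -/
theorem dil_sub (c : E) (μ : ℝ) (x : E) : dil c μ x - x = (1 - μ) • (c - x) := by
  simp only [dil, smul_sub, sub_smul, one_smul]
  abel

/-- `‖dil c μ x - x‖ = |1 - μ| ‖x - c‖`. [folklore] -/
theorem norm_dil_sub (c : E) (μ : ℝ) (x : E) : ‖dil c μ x - x‖ = |1 - μ| * ‖x - c‖ := by
  rw [dil_sub, norm_smul, Real.norm_eq_abs, norm_sub_rev]

/-- `dil c μ x - c = μ (x - c)`. [folklore] -/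
theorem dil_sub_center (c : E) (μ : ℝ) (x : E) : dil c μ x - c = μ • (x - c) := by
  simp [dil]

/-- Dilations are smooth (affine). [folklore] -/
theorem contDiff_dil (c : E) (μ : ℝ) {n : WithTop ℕ∞} : ContDiff ℝ n (dil c μ) :=
  contDiff_const.add ((contDiff_id.sub contDiff_const).const_smul μ)

/-- Dilations are continuous. [folklore] -/
theorem continuous_dil (c : E) (μ : ℝ) : Continuous (dil c μ) :=
  (contDiff_dil c μ (n := 0)).continuous

/-- Dilations are continuous in the ratio. [folklore] -/
theorem continuous_dil_left (c x : E) : Continuous fun μ : ℝ => dil c μ x :=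
  continuous_const.add (continuous_id.smul continuous_const)

/-! ### Geometry of dilations in a convex body -/

section Geometry

variable {K : Set E} {c : E} {r : ℝ}

/-- **The interior ball about a dilate**: if `closedBall c r ⊆ K`, `K` convex, `b ∈ K` and
`0 ≤ μ ≤ 1`, then `ball (dil c μ b) ((1 - μ) r) ⊆ K` (the convex hull of `b` and the ball about
`c`). [folklore] -/
theorem ball_dil_subset (hK : Convex ℝ K) (hball : closedBall c r ⊆ K) {b : E} (hb : b ∈ K)
    {μ : ℝ} (hμ0 : 0 ≤ μ) (hμ1 : μ ≤ 1) : ball (dil c μ b) ((1 - μ) * r) ⊆ K := by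
  intro z hz
  rw [mem_ball, dist_eq_norm] at hz
  have h1μ : 0 < 1 - μ := by
    rcases eq_or_lt_of_le hμ1 with h | h
    · rw [h, sub_self, zero_mul] at hz
      exact absurd hz (not_lt.2 (norm_nonneg _))
    · linarith
  have hr : 0 < r := by
    by_contra hr
    have : (1 - μ) * r ≤ 0 := mul_nonpos_of_nonneg_of_nonpos h1μ.le (not_lt.1 hr)
    linarith [norm_nonneg (z - dil c μ b)]
  set w : E := z - dil c μ b with hw
  set y : E := c + (1 - μ)⁻¹ • w with hy
  have hyK : y ∈ K := by
    refine hball ?_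
    rw [mem_closedBall, dist_eq_norm, hy, add_sub_cancel_left, norm_smul, norm_inv,
      Real.norm_of_nonneg h1μ.le, inv_mul_le_iff₀ h1μ]
    exact hz.le
  have hz' : z = (1 - μ) • y + μ • b := by
    rw [hy, smul_add, smul_inv_smul₀ h1μ.ne', hw, dil]
    simp only [smul_sub, sub_smul, one_smul]
    abel
  rw [hz']
  exact hK hyK hb h1μ.le hμ0 (by ring)

/-- **Dilates of nearby points are interior**: with `closedBall c r ⊆ K`, `K` convex, `b ∈ K`,
`0 ≤ μ ≤ 1` and `μ ‖x - b‖ < (1 - μ) r`, the dilate `dil c μ x` lies in the interior of `K`.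
[folklore] -/
theorem dil_mem_interior (hK : Convex ℝ K) (hball : closedBall c r ⊆ K) {b : E} (hb : b ∈ K)
    {μ : ℝ} (hμ0 : 0 ≤ μ) (hμ1 : μ ≤ 1) {x : E} (hx : μ * ‖x - b‖ < (1 - μ) * r) :
    dil c μ x ∈ interior K := by
  have hsub := ball_dil_subset hK hball hb hμ0 hμ1
  have hmem : dil c μ x ∈ ball (dil c μ b) ((1 - μ) * r) := by
    rw [mem_ball, dist_eq_norm, dil_sub_dil, norm_smul, Real.norm_of_nonneg hμ0]
    exact hx
  exact isOpen_ball.subset_interior_iff.2 hsub hmem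

/-- A convenient form: if `‖x - b‖ ≤ δ` with `b ∈ K`, `0 ≤ μ ≤ 1` and `δ < (1 - μ) r`, then
`dil c μ x ∈ interior K`. [folklore] -/
theorem dil_mem_interior_of_le (hK : Convex ℝ K) (hball : closedBall c r ⊆ K) {b : E}
    (hb : b ∈ K) {μ : ℝ} (hμ0 : 0 ≤ μ) (hμ1 : μ ≤ 1) {x : E} {δ : ℝ} (hxb : ‖x - b‖ ≤ δ)
    (hδ : δ < (1 - μ) * r) : dil c μ x ∈ interior K := by
  refine dil_mem_interior hK hball hb hμ0 hμ1 (lt_of_le_of_lt ?_ hδ)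
  calc μ * ‖x - b‖ ≤ 1 * δ := mul_le_mul hμ1 hxb (norm_nonneg _) zero_le_one
    _ = δ := one_mul δ

/-- Dilates of points of `K` stay in `K` (`0 ≤ μ ≤ 1`, `c ∈ K`). [folklore] -/
theorem dil_mem (hK : Convex ℝ K) (hc : c ∈ K) {b : E} (hb : b ∈ K) {μ : ℝ} (hμ0 : 0 ≤ μ)
    (hμ1 : μ ≤ 1) : dil c μ b ∈ K := by
  have : dil c μ b = (1 - μ) • c + μ • b := by
    simp only [dil, smul_sub, sub_smul, one_smul]; abel
  rw [this]
  exact hK hc hb (by linarith) hμ0 (by ring)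

/-- Distance from a dilate to a point of `K`: `‖dil c μ x - b‖ ≤ ‖x - b‖ + (1 - μ) ‖x - c‖` for
`μ ≤ 1`. [folklore] -/
theorem norm_dil_sub_le (c : E) {μ : ℝ} (hμ1 : μ ≤ 1) (x b : E) :
    ‖dil c μ x - b‖ ≤ ‖x - b‖ + (1 - μ) * ‖x - c‖ := by
  have h : dil c μ x - b = (x - b) + (dil c μ x - x) := by abel
  rw [h]
  refine (norm_add_le _ _).trans ?_
  rw [norm_dil_sub, abs_of_nonneg (by linarith)]

end Geometry

/-! ### Derivatives of a function composed with a dilation -/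

section DilDeriv

variable {f : E → F} {s : Set E}

/-- **Derivatives through a dilation**: for `f` smooth on an open set `s` and `dil c μ x ∈ s`,
`Dⁿ (f ∘ dil c μ) (x) = μⁿ • Dⁿ f (dil c μ x)` (translation invariance of `iteratedFDeriv` and
the chain rule for the linear map `μ • id`, `ContinuousLinearMap.iteratedFDerivWithin_comp_right`).
[folklore] -/
theorem iteratedFDeriv_comp_dil (hs : IsOpen s) (hf : ContDiffOn ℝ ∞ f s) (c : E) (μ : ℝ) {x : E}
    (hx : dil c μ x ∈ s) (n : ℕ) :
    iteratedFDeriv ℝ n (fun y => f (dil c μ y)) x = μ ^ n • iteratedFDeriv ℝ n f (dil c μ x) := by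
  -- remove the translation by `c` in the source
  have h3 : iteratedFDeriv ℝ n (fun y => f (dil c μ y)) x =
      iteratedFDeriv ℝ n (fun z => f (c + μ • z)) (x - c) :=
    iteratedFDeriv_comp_sub n c x (f := fun z => f (c + μ • z))
  -- the linear dilation
  set L : E →L[ℝ] E := μ • ContinuousLinearMap.id ℝ E with hL
  set g₁ : E → F := fun y => f (c + y) with hg₁
  set s₁ : Set E := {y | c + y ∈ s} with hs₁_def
  have hs₁ : IsOpen s₁ := hs.preimage (continuous_const.add continuous_id)
  have hg₁s : ContDiffOn ℝ ∞ g₁ s₁ :=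
    hf.comp (contDiff_const.add contDiff_id).contDiffOn fun y hy => hy
  have hLx : L (x - c) ∈ s₁ := by
    show c + μ • (x - c) ∈ s
    exact hx
  have hLs₁ : IsOpen (L ⁻¹' s₁) := hs₁.preimage L.continuous
  have h2 : iteratedFDeriv ℝ n (fun z => f (c + μ • z)) (x - c) =
      (iteratedFDeriv ℝ n g₁ (L (x - c))).compContinuousLinearMap fun _ => L := by
    have key := L.iteratedFDerivWithin_comp_right (f := g₁) hg₁s hs₁.uniqueDiffOn
      hLs₁.uniqueDiffOn hLx (i := n) (by exact_mod_cast le_top)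
    rw [(iteratedFDerivWithin_of_isOpen n hLs₁) (show x - c ∈ L ⁻¹' s₁ from hLx),
      (iteratedFDerivWithin_of_isOpen n hs₁) hLx] at key
    have hfun : (fun z => f (c + μ • z)) = g₁ ∘ L := by
      funext z
      simp [hg₁, hL]
    rw [hfun, key]
  -- remove the translation by `c` in the target
  have h1 : iteratedFDeriv ℝ n g₁ (L (x - c)) = iteratedFDeriv ℝ n f (dil c μ x) := by
    rw [hg₁, iteratedFDeriv_comp_add_left]
    rfl
  rw [h3, h2, h1]
  ext v
  rw [ContinuousMultilinearMap.compContinuousLinearMap_apply, smul_apply]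
  have hv : (fun i : Fin n => L (v i)) = fun i => μ • v i := by
    funext i; simp [hL]
  rw [hv, ContinuousMultilinearMap.map_smul_univ, prod_const, card_univ, Fintype.card_fin]

/-- `f ∘ dil c μ` is smooth at `x` when `dil c μ x` lies in an open set where `f` is smooth.
[folklore] -/
theorem contDiffAt_comp_dil (hs : IsOpen s) (hf : ContDiffOn ℝ ∞ f s) (c : E) (μ : ℝ) {x : E}
    (hx : dil c μ x ∈ s) : ContDiffAt ℝ ∞ (fun y => f (dil c μ y)) x :=
  (hf.contDiffAt (hs.mem_nhds hx)).comp x (contDiff_dil c μ).contDiffAt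

end DilDeriv

/-! ### The approximants -/

section Approx

variable {f : E → F} {s : Set E}

/-- **The dilation–extrapolation approximant** of order `n` at scale `t`:
`approx f c n t x = ∑_{j ≤ n} w_j • f (c + (1 - 2^j t)(x - c))`. [folklore] -/
def approx (f : E → F) (c : E) (n : ℕ) (t : ℝ) (x : E) : F :=
  ∑ j ∈ range (n + 1), weight (n + 1) j • f (dil c (dnode t j) x)

/-- Unfolding the approximant. [folklore] -/
theorem approx_apply (f : E → F) (c : E) (n : ℕ) (t : ℝ) (x : E) :
    approx f c n t x = ∑ j ∈ range (n + 1), weight (n + 1) j • f (dil c (dnode t j) x) := rfl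

/-- At scale `0` the approximant is `f` itself (all nodes are `1`, the weights sum to `1`).
[folklore] -/
theorem approx_zero_scale (f : E → F) (c : E) (n : ℕ) (x : E) : approx f c n 0 x = f x := by
  simp only [approx_apply, dnode_apply, mul_zero, sub_zero, dil_one, ← sum_smul,
    sum_weight (Nat.succ_pos n), one_smul]

/-- The set of points all of whose dilates at the nodes lie in `s`. [folklore] -/
def goodSet (s : Set E) (c : E) (n : ℕ) (t : ℝ) : Set E :=
  {x | ∀ j, j < n + 1 → dil c (dnode t j) x ∈ s}

/-- Membership in `goodSet`. [folklore] -/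
theorem mem_goodSet {s : Set E} {c : E} {n : ℕ} {t : ℝ} {x : E} :
    x ∈ goodSet s c n t ↔ ∀ j, j < n + 1 → dil c (dnode t j) x ∈ s := Iff.rfl

/-- `goodSet` of an open set is open. [folklore] -/
theorem isOpen_goodSet (hs : IsOpen s) (c : E) (n : ℕ) (t : ℝ) : IsOpen (goodSet s c n t) := by
  have h : goodSet s c n t = ⋂ j ∈ range (n + 1), dil c (dnode t j) ⁻¹' s := by
    ext x
    simp only [mem_goodSet, mem_iInter, Finset.mem_range, Set.mem_preimage]
  rw [h]
  exact isOpen_biInter_finset fun j _ => hs.preimage (continuous_dil _ _)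

/-- The approximant is smooth at points all of whose dilates lie in an open set where `f` is
smooth. [folklore] -/
theorem contDiffAt_approx (hs : IsOpen s) (hf : ContDiffOn ℝ ∞ f s) (c : E) (n : ℕ) (t : ℝ)
    {x : E} (hx : x ∈ goodSet s c n t) : ContDiffAt ℝ ∞ (approx f c n t) x := by
  have h : approx f c n t = fun x => ∑ j ∈ range (n + 1), weight (n + 1) j • f (dil c (dnode t j) x) :=
    rfl
  rw [h]
  exact ContDiffAt.sum fun j hj => (contDiffAt_comp_dil hs hf c _ (hx j (mem_range.1 hj))).const_smul _

/-- The approximant is smooth on `goodSet`. [folklore] -/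
theorem contDiffOn_approx (hs : IsOpen s) (hf : ContDiffOn ℝ ∞ f s) (c : E) (n : ℕ) (t : ℝ) :
    ContDiffOn ℝ ∞ (approx f c n t) (goodSet s c n t) := fun _ hx =>
  (contDiffAt_approx hs hf c n t hx).contDiffWithinAt

/-- **The derivative formula**: at a good point,
`Dᵞ (approx f c n t) x = ∑_j (w_j μ_jᵞ) • Dᵞ f (dil c μ_j x)`. [folklore] -/
theorem iteratedFDeriv_approx (hs : IsOpen s) (hf : ContDiffOn ℝ ∞ f s) (c : E) (n : ℕ) (t : ℝ)
    {x : E} (hx : x ∈ goodSet s c n t) (γ : ℕ) :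
    iteratedFDeriv ℝ γ (approx f c n t) x =
      ∑ j ∈ range (n + 1), (weight (n + 1) j * dnode t j ^ γ) •
        iteratedFDeriv ℝ γ f (dil c (dnode t j) x) := by
  have h : approx f c n t = fun x => ∑ j ∈ range (n + 1), weight (n + 1) j • f (dil c (dnode t j) x) :=
    rfl
  have hterm : ∀ j ∈ range (n + 1), ContDiffAt ℝ γ (fun y => f (dil c (dnode t j) y)) x :=
    fun j hj => (contDiffAt_comp_dil hs hf c _ (hx j (mem_range.1 hj))).of_le (by exact_mod_cast le_top)
  rw [h, iteratedFDeriv_fun_sum_apply fun j hj => (hterm j hj).const_smul _]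
  refine sum_congr rfl fun j hj => ?_
  rw [iteratedFDeriv_const_smul_apply' (hterm j hj), iteratedFDeriv_comp_dil hs hf c _
    (hx j (mem_range.1 hj)), smul_smul]

end Approx

/-! ### The jet of `f` within `K` -/

section Jet

variable {f : E → F} {K : Set E}

/-- An order bookkeeping fact: `∞ + i ≤ ∞` in `ℕ∞ω`. [folklore] -/
theorem infty_add_natCast_le (i : ℕ) : (∞ : ℕ∞ω) + (i : ℕ∞ω) ≤ ∞ := by
  rw [show ((i : ℕ∞ω)) = ((i : ℕ∞) : ℕ∞ω) from rfl, ← WithTop.coe_add, top_add]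

/-- At interior points the within-derivatives are the derivatives. [folklore] -/
theorem iteratedFDerivWithin_eq_of_mem_interior (hf : ContDiffOn ℝ ∞ f K)
    (hKu : UniqueDiffOn ℝ K) {z : E} (hz : z ∈ interior K) (γ : ℕ) :
    iteratedFDerivWithin ℝ γ f K z = iteratedFDeriv ℝ γ f z :=
  iteratedFDerivWithin_eq_iteratedFDeriv hKu
    ((hf.contDiffAt (mem_interior_iff_mem_nhds.1 hz)).of_le (by exact_mod_cast le_top))
    (interior_subset hz)

/-- The jet `p_γ = iteratedFDerivWithin ℝ γ f K` is `C^∞` within `K`. [folklore] -/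
theorem contDiffOn_jet (hf : ContDiffOn ℝ ∞ f K) (hKu : UniqueDiffOn ℝ K) (γ : ℕ) :
    ContDiffOn ℝ ∞ (iteratedFDerivWithin ℝ γ f K) K := fun z hz =>
  (hf z hz).iteratedFDerivWithin_right hKu (infty_add_natCast_le γ) hz

/-- The jet is `C^∞` on the interior of `K` (in the ordinary sense there). [folklore] -/
theorem contDiffOn_jet_interior (hf : ContDiffOn ℝ ∞ f K) (hKu : UniqueDiffOn ℝ K) (γ : ℕ) :
    ContDiffOn ℝ ∞ (iteratedFDerivWithin ℝ γ f K) (interior K) :=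
  (contDiffOn_jet hf hKu γ).mono interior_subset

/-- The jet is smooth at interior points. [folklore] -/
theorem contDiffAt_jet (hf : ContDiffOn ℝ ∞ f K) (hKu : UniqueDiffOn ℝ K) (γ : ℕ) {z : E}
    (hz : z ∈ interior K) : ContDiffAt ℝ ∞ (iteratedFDerivWithin ℝ γ f K) z :=
  (contDiffOn_jet_interior hf hKu γ).contDiffAt (isOpen_interior.mem_nhds hz)

/-- The within-derivatives of the jet are continuous on `K`. [folklore] -/
theorem continuousOn_iteratedFDerivWithin_jet (hf : ContDiffOn ℝ ∞ f K) (hKu : UniqueDiffOn ℝ K)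
    (γ m : ℕ) : ContinuousOn (iteratedFDerivWithin ℝ m (iteratedFDerivWithin ℝ γ f K) K) K :=
  (contDiffOn_jet hf hKu γ).continuousOn_iteratedFDerivWithin (by exact_mod_cast le_top) hKu

/-- The jet itself is continuous on `K`. [folklore] -/
theorem continuousOn_jet (hf : ContDiffOn ℝ ∞ f K) (hKu : UniqueDiffOn ℝ K) (γ : ℕ) :
    ContinuousOn (iteratedFDerivWithin ℝ γ f K) K :=
  hf.continuousOn_iteratedFDerivWithin (by exact_mod_cast le_top) hKu

/-- **Uniform bounds for the derivatives of the jet on a compact body**: `‖Dᵐ_K p_γ (z)‖ ≤ B`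
on `K`. [folklore] -/
theorem exists_bound_iteratedFDerivWithin_jet (hf : ContDiffOn ℝ ∞ f K) (hKu : UniqueDiffOn ℝ K)
    (hKc : IsCompact K) (γ m : ℕ) :
    ∃ B : ℝ, 0 ≤ B ∧ ∀ z ∈ K, ‖iteratedFDerivWithin ℝ m (iteratedFDerivWithin ℝ γ f K) K z‖ ≤ B := by
  obtain ⟨B, hB⟩ := hKc.exists_bound_of_continuousOn
    (continuousOn_iteratedFDerivWithin_jet hf hKu γ m)
  exact ⟨max B 0, le_max_right _ _, fun z hz => (hB z hz).trans (le_max_left _ _)⟩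

/-- At interior points, derivatives of the jet are its within-derivatives. [folklore] -/
theorem iteratedFDeriv_jet_eq (hf : ContDiffOn ℝ ∞ f K) (hKu : UniqueDiffOn ℝ K) (γ m : ℕ)
    {z : E} (hz : z ∈ interior K) :
    iteratedFDeriv ℝ m (iteratedFDerivWithin ℝ γ f K) z =
      iteratedFDerivWithin ℝ m (iteratedFDerivWithin ℝ γ f K) K z :=
  (iteratedFDerivWithin_eq_iteratedFDeriv hKu
    ((contDiffAt_jet hf hKu γ hz).of_le (by exact_mod_cast le_top)) (interior_subset hz)).symm

end Jet

/-! ### The jet along a ray -/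

section LineJet

variable {f : E → F} {K : Set E}

/-- **The jet along the ray** through `x` from the centre `c`:
`lineJet f K c x γ μ = μᵞ • p_γ (dil c μ x)`, `p_γ = iteratedFDerivWithin ℝ γ f K`. [folklore] -/
def lineJet (f : E → F) (K : Set E) (c x : E) (γ : ℕ) (μ : ℝ) : E [×γ]→L[ℝ] F :=
  μ ^ γ • iteratedFDerivWithin ℝ γ f K (dil c μ x)

/-- Unfolding `lineJet`. [folklore] -/
theorem lineJet_apply (f : E → F) (K : Set E) (c x : E) (γ : ℕ) (μ : ℝ) :
    lineJet f K c x γ μ = μ ^ γ • iteratedFDerivWithin ℝ γ f K (dil c μ x) := rfl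

/-- The (open) set of ratios dilating `x` into the interior of `K`. [folklore] -/
def raySet (K : Set E) (c x : E) : Set ℝ := {μ | dil c μ x ∈ interior K}

/-- Membership in `raySet`. [folklore] -/
theorem mem_raySet {K : Set E} {c x : E} {μ : ℝ} : μ ∈ raySet K c x ↔ dil c μ x ∈ interior K :=
  Iff.rfl

omit [NormedSpace ℝ F] in
/-- `raySet` is open. [folklore] -/
theorem isOpen_raySet (K : Set E) (c x : E) : IsOpen (raySet K c x) :=
  isOpen_interior.preimage (continuous_dil_left c x)

/-- The ray `μ ↦ dil c μ x` is smooth. [folklore] -/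
theorem contDiff_dil_left (c x : E) {n : WithTop ℕ∞} : ContDiff ℝ n fun μ : ℝ => dil c μ x :=
  contDiff_const.add (contDiff_id.smul contDiff_const)

/-- **The derivatives of the approximant through the line jet**: at a point all of whose node
dilates are interior, `Dᵞ (approx f c n t) x = ∑_j w_j • lineJet f K c x γ (μ_j)`. [folklore] -/
theorem iteratedFDeriv_approx_eq_sum_lineJet (hf : ContDiffOn ℝ ∞ f K) (hKu : UniqueDiffOn ℝ K)
    (c : E) (n : ℕ) (t : ℝ) {x : E} (hx : x ∈ goodSet (interior K) c n t) (γ : ℕ) :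
    iteratedFDeriv ℝ γ (approx f c n t) x =
      ∑ j ∈ range (n + 1), weight (n + 1) j • lineJet f K c x γ (dnode t j) := by
  rw [iteratedFDeriv_approx isOpen_interior (hf.mono interior_subset) c n t hx γ]
  refine sum_congr rfl fun j hj => ?_
  rw [lineJet_apply, smul_smul,
    iteratedFDerivWithin_eq_of_mem_interior hf hKu (hx j (mem_range.1 hj)) γ]

/-- The line jet is smooth on `raySet`. [folklore] -/
theorem contDiffOn_lineJet (hf : ContDiffOn ℝ ∞ f K) (hKu : UniqueDiffOn ℝ K) (c x : E) (γ : ℕ) :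
    ContDiffOn ℝ ∞ (lineJet f K c x γ) (raySet K c x) := by
  have h1 : ContDiffOn ℝ ∞ (fun μ : ℝ => iteratedFDerivWithin ℝ γ f K (dil c μ x)) (raySet K c x) :=
    (contDiffOn_jet_interior hf hKu γ).comp (contDiff_dil_left c x).contDiffOn fun μ hμ => hμ
  exact (contDiff_id.pow γ).contDiffOn.smul h1

/-- The line jet is smooth at points of `raySet`. [folklore] -/
theorem contDiffAt_lineJet (hf : ContDiffOn ℝ ∞ f K) (hKu : UniqueDiffOn ℝ K) (c x : E) (γ : ℕ)
    {μ : ℝ} (hμ : μ ∈ raySet K c x) : ContDiffAt ℝ ∞ (lineJet f K c x γ) μ :=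
  (contDiffOn_lineJet hf hKu c x γ).contDiffAt ((isOpen_raySet K c x).mem_nhds hμ)

/-! ### Derivative bounds for the line jet -/

/-- The derivatives of `μ ↦ μᵞ` are bounded on `[0, 1]`, all orders `≤ N` at once. [folklore] -/
theorem exists_bound_iteratedFDeriv_pow (γ N : ℕ) :
    ∃ P : ℝ, 0 ≤ P ∧ ∀ i, i ≤ N → ∀ μ ∈ Icc (0 : ℝ) 1,
      ‖iteratedFDeriv ℝ i (fun μ : ℝ => μ ^ γ) μ‖ ≤ P := by
  have h : ∀ i : ℕ, ∃ P : ℝ, 0 ≤ P ∧ ∀ μ ∈ Icc (0 : ℝ) 1,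
      ‖iteratedFDeriv ℝ i (fun μ : ℝ => μ ^ γ) μ‖ ≤ P := by
    intro i
    have hc : Continuous fun μ : ℝ => ‖iteratedFDeriv ℝ i (fun μ : ℝ => μ ^ γ) μ‖ :=
      ((contDiff_id.pow γ).continuous_iteratedFDeriv (by exact_mod_cast le_top)).norm
    obtain ⟨P, hP⟩ := isCompact_Icc.exists_bound_of_continuousOn hc.continuousOn
    refine ⟨max P 0, le_max_right _ _, fun μ hμ => ?_⟩
    have := hP μ hμ
    rw [Real.norm_of_nonneg (norm_nonneg _)] at this
    exact this.trans (le_max_left _ _)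
  choose P hP0 hP using h
  refine ⟨∑ i ∈ range (N + 1), P i, sum_nonneg fun i _ => hP0 i, fun i hi μ hμ => ?_⟩
  exact (hP i μ hμ).trans (single_le_sum (f := P) (fun i _ => hP0 i)
    (mem_range.2 (Nat.lt_succ_of_le hi)))

/-- **Derivatives of the jet along the affine ray**: for `μ` with `dil c μ x` interior,
`‖Dᵐ (μ ↦ p_γ (dil c μ x)) (μ)‖ ≤ ‖Dᵐ_K p_γ (dil c μ x)‖ ‖x - c‖ᵐ` (chain rule for the affine
map `μ ↦ c + μ (x - c)`). [folklore] -/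
theorem norm_iteratedFDeriv_jet_comp_ray_le (hf : ContDiffOn ℝ ∞ f K) (hKu : UniqueDiffOn ℝ K)
    (c x : E) (γ m : ℕ) {μ : ℝ} (hμ : dil c μ x ∈ interior K) :
    ‖iteratedFDeriv ℝ m (fun ν : ℝ => iteratedFDerivWithin ℝ γ f K (dil c ν x)) μ‖ ≤
      ‖iteratedFDerivWithin ℝ m (iteratedFDerivWithin ℝ γ f K) K (dil c μ x)‖ * ‖x - c‖ ^ m := by
  set p : E → E [×γ]→L[ℝ] F := iteratedFDerivWithin ℝ γ f K with hp
  set L : ℝ →L[ℝ] E := (ContinuousLinearMap.id ℝ ℝ).smulRight (x - c) with hL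
  have hLapply : ∀ ν : ℝ, L ν = ν • (x - c) := fun ν => by simp [hL]
  set g : E → E [×γ]→L[ℝ] F := fun y => p (c + y) with hg
  set s₁ : Set E := {y | c + y ∈ interior K} with hs₁_def
  have hs₁ : IsOpen s₁ := isOpen_interior.preimage (continuous_const.add continuous_id)
  have hgs : ContDiffOn ℝ ∞ g s₁ :=
    (contDiffOn_jet_interior hf hKu γ).comp (contDiff_const.add contDiff_id).contDiffOn
      fun y hy => hy
  have hLμ : L μ ∈ s₁ := by
    show c + L μ ∈ interior K
    rw [hLapply]; exact hμ
  have hLs₁ : IsOpen (L ⁻¹' s₁) := hs₁.preimage L.continuous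
  -- the function along the ray is `g ∘ L`
  have hfun : (fun ν : ℝ => p (dil c ν x)) = g ∘ L := by
    funext ν
    simp only [comp_apply, hg, hLapply, dil]
  have key := L.iteratedFDerivWithin_comp_right (f := g) hgs hs₁.uniqueDiffOn hLs₁.uniqueDiffOn
    hLμ (i := m) (by exact_mod_cast le_top)
  rw [(iteratedFDerivWithin_of_isOpen m hLs₁) (show μ ∈ L ⁻¹' s₁ from hLμ),
    (iteratedFDerivWithin_of_isOpen m hs₁) hLμ] at key
  have htrans : iteratedFDeriv ℝ m g (L μ) = iteratedFDeriv ℝ m p (dil c μ x) := by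
    rw [hg, iteratedFDeriv_comp_add_left]
    simp only [hLapply, dil]
  rw [hfun, key, htrans, iteratedFDeriv_jet_eq hf hKu γ m hμ]
  refine (ContinuousMultilinearMap.norm_compContinuousLinearMap_le _ _).trans ?_
  rw [prod_const, card_univ, Fintype.card_fin]
  refine mul_le_mul_of_nonneg_left (pow_le_pow_left₀ (norm_nonneg _) ?_ m) (norm_nonneg _)
  refine ContinuousLinearMap.opNorm_le_bound _ (norm_nonneg _) fun ν => ?_
  rw [hLapply, norm_smul, mul_comm]

/-- **Uniform bounds for the `μ`-derivatives of the line jet** on a compact body: for every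
order `N` and radius `R` there is `B` with `‖Dⁱ (lineJet f K c x γ) (μ)‖ ≤ B` for all `i ≤ N`,
all `x` with `‖x - c‖ ≤ R`, and all `μ ∈ [0, 1]` dilating `x` into the interior (Leibniz rule
for `μᵞ • p_γ (dil c μ x)`). [folklore] -/
theorem exists_bound_iteratedFDeriv_lineJet (hf : ContDiffOn ℝ ∞ f K) (hKu : UniqueDiffOn ℝ K)
    (hKc : IsCompact K) (c : E) (γ N : ℕ) (R : ℝ) :
    ∃ B : ℝ, 0 ≤ B ∧ ∀ x : E, ‖x - c‖ ≤ R → ∀ i, i ≤ N → ∀ μ ∈ Icc (0 : ℝ) 1,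
      dil c μ x ∈ interior K → ‖iteratedFDeriv ℝ i (lineJet f K c x γ) μ‖ ≤ B := by
  obtain ⟨P, hP0, hP⟩ := exists_bound_iteratedFDeriv_pow γ N
  have hB : ∀ m : ℕ, ∃ B : ℝ, 0 ≤ B ∧
      ∀ z ∈ K, ‖iteratedFDerivWithin ℝ m (iteratedFDerivWithin ℝ γ f K) K z‖ ≤ B :=
    fun m => exists_bound_iteratedFDerivWithin_jet hf hKu hKc γ m
  choose Bj hBj0 hBj using hB
  set Bsum : ℝ := ∑ m ∈ range (N + 1), Bj m with hBsum
  have hBsum0 : 0 ≤ Bsum := sum_nonneg fun m _ => hBj0 m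
  have hBj_le : ∀ m, m ≤ N → Bj m ≤ Bsum := fun m hm =>
    single_le_sum (f := Bj) (fun m _ => hBj0 m) (mem_range.2 (Nat.lt_succ_of_le hm))
  set R' : ℝ := max R 1 with hR'
  have hR'1 : 1 ≤ R' := le_max_right _ _
  -- the constant
  refine ⟨2 ^ N * P * Bsum * R' ^ N, by positivity, fun x hxR i hi μ hμ hμK => ?_⟩
  have hO : IsOpen (raySet K c x) := isOpen_raySet K c x
  have hμO : μ ∈ raySet K c x := hμK
  -- Leibniz rule within the open set `raySet`
  have h1 : ContDiffOn ℝ ∞ (fun ν : ℝ => ν ^ γ) (raySet K c x) := (contDiff_id.pow γ).contDiffOn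
  have h2 : ContDiffOn ℝ ∞ (fun ν : ℝ => iteratedFDerivWithin ℝ γ f K (dil c ν x)) (raySet K c x) :=
    (contDiffOn_jet_interior hf hKu γ).comp (contDiff_dil_left c x).contDiffOn fun ν hν => hν
  have hleib := norm_iteratedFDerivWithin_smul_le (N := ∞) h1 h2 hO.uniqueDiffOn hμO (n := i)
    (by exact_mod_cast le_top)
  have hfun : (fun ν : ℝ => ν ^ γ • iteratedFDerivWithin ℝ γ f K (dil c ν x)) = lineJet f K c x γ :=
    rfl
  rw [hfun, (iteratedFDerivWithin_of_isOpen i hO) hμO] at hleib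
  refine hleib.trans ?_
  -- bound each term
  have hterm : ∀ l ∈ range (i + 1),
      (i.choose l : ℝ) * ‖iteratedFDerivWithin ℝ l (fun ν : ℝ => ν ^ γ) (raySet K c x) μ‖ *
        ‖iteratedFDerivWithin ℝ (i - l) (fun ν : ℝ => iteratedFDerivWithin ℝ γ f K (dil c ν x))
          (raySet K c x) μ‖ ≤ (i.choose l : ℝ) * (P * (Bsum * R' ^ N)) := by
    intro l hl
    have hli : l ≤ i := Nat.lt_succ_iff.1 (mem_range.1 hl)
    rw [(iteratedFDerivWithin_of_isOpen l hO) hμO, (iteratedFDerivWithin_of_isOpen (i - l) hO) hμO,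
      mul_assoc]
    refine mul_le_mul_of_nonneg_left ?_ (Nat.cast_nonneg (α := ℝ) _)
    refine mul_le_mul (hP l (hli.trans hi) μ hμ) ?_ (norm_nonneg _) hP0
    refine (norm_iteratedFDeriv_jet_comp_ray_le hf hKu c x γ (i - l) hμK).trans ?_
    refine mul_le_mul ((hBj (i - l) _ (interior_subset hμK)).trans (hBj_le _ (by omega))) ?_
      (by positivity) hBsum0
    calc ‖x - c‖ ^ (i - l) ≤ R' ^ (i - l) :=
          pow_le_pow_left₀ (norm_nonneg _) (hxR.trans (le_max_left _ _)) _
      _ ≤ R' ^ N := pow_le_pow_right₀ hR'1 (by omega)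
  refine (sum_le_sum hterm).trans ?_
  rw [← sum_mul]
  have hchoose : ∑ l ∈ range (i + 1), (i.choose l : ℝ) = 2 ^ i := by
    have := Nat.sum_range_choose i
    exact_mod_cast this
  rw [hchoose]
  have h2i : (2 : ℝ) ^ i ≤ 2 ^ N := pow_le_pow_right₀ (by norm_num) hi
  calc (2 : ℝ) ^ i * (P * (Bsum * R' ^ N)) ≤ 2 ^ N * (P * (Bsum * R' ^ N)) :=
        mul_le_mul_of_nonneg_right h2i (by positivity)
    _ = 2 ^ N * P * Bsum * R' ^ N := by ring

/-! ### The extrapolation estimate -/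

/-- The algebra of the extrapolation estimate: two weighted node sums of `ψ` which both carry
the same Taylor polynomial `T` to the point `1` differ by at most the total weight mass times a
common bound `D` for the Taylor remainders at the nodes. [folklore] -/
theorem norm_sum_weight_smul_sub_le {G : Type*} [NormedAddCommGroup G] [NormedSpace ℝ G]
    {ψ : ℝ → G} {a b : ℝ} {n q q' : ℕ} (hq : n < q) (hq' : n < q') {t t' D : ℝ}
    (hrem : ∀ j, j < q → ‖ψ (dnode t j) - taylorWithinEval ψ n (Icc a b) a (dnode t j)‖ ≤ D)
    (hrem' : ∀ j, j < q' → ‖ψ (dnode t' j) - taylorWithinEval ψ n (Icc a b) a (dnode t' j)‖ ≤ D) :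
    ‖∑ j ∈ range q, weight q j • ψ (dnode t j) - ∑ j ∈ range q', weight q' j • ψ (dnode t' j)‖ ≤
      (weightMass q + weightMass q') * D := by
  set T : ℝ → G := fun μ => taylorWithinEval ψ n (Icc a b) a μ with hT
  have hrepr : ∑ j ∈ range q, weight q j • T (dnode t j) = T 1 :=
    sum_weight_smul_taylorWithinEval hq ψ (Icc a b) a t
  have hrepr' : ∑ j ∈ range q', weight q' j • T (dnode t' j) = T 1 :=
    sum_weight_smul_taylorWithinEval hq' ψ (Icc a b) a t'
  have hsplit : ∑ j ∈ range q, weight q j • ψ (dnode t j) - ∑ j ∈ range q', weight q' j • ψ (dnode t' j) =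
      ∑ j ∈ range q, weight q j • (ψ (dnode t j) - T (dnode t j)) -
        ∑ j ∈ range q', weight q' j • (ψ (dnode t' j) - T (dnode t' j)) := by
    simp only [smul_sub, sum_sub_distrib, hrepr, hrepr']
    abel
  rw [hsplit, add_mul]
  exact (norm_sub_le _ _).trans (add_le_add (norm_sum_weight_smul_le _ hrem)
    (norm_sum_weight_smul_le _ hrem'))

/-- Taylor's theorem for the line jet on a segment of ratios dilating `x` into the interior:
with `B` bounding the `(n+1)`-st `μ`-derivative, the remainder of order `n` at `a` is at most
`B (μ - a)ⁿ⁺¹ / n!`. [folklore] -/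
theorem norm_lineJet_sub_taylor_le (hf : ContDiffOn ℝ ∞ f K) (hKu : UniqueDiffOn ℝ K) (c x : E)
    (γ n : ℕ) {a b : ℝ} (hab : a < b) (hseg : Icc a b ⊆ raySet K c x) {B : ℝ}
    (hB : ∀ μ ∈ Icc a b, ‖iteratedFDeriv ℝ (n + 1) (lineJet f K c x γ) μ‖ ≤ B) {μ : ℝ}
    (hμ : μ ∈ Icc a b) :
    ‖lineJet f K c x γ μ - taylorWithinEval (lineJet f K c x γ) n (Icc a b) a μ‖ ≤
      B * (μ - a) ^ (n + 1) / n ! := by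
  set ψ := lineJet f K c x γ with hψ_def
  have hψ : ContDiffOn ℝ (n + 1) ψ (Icc a b) := fun ν hν =>
    ((contDiffAt_lineJet hf hKu c x γ (hseg hν)).of_le (by exact_mod_cast le_top)).contDiffWithinAt
  refine taylor_mean_remainder_bound hab.le hψ hμ fun y hy => ?_
  rw [iteratedDerivWithin_eq_iteratedDeriv (uniqueDiffOn_Icc hab)
    ((contDiffAt_lineJet hf hKu c x γ (hseg hy)).of_le (by exact_mod_cast le_top)) hy,
    ← norm_iteratedFDeriv_eq_norm_iteratedDeriv]
  exact hB y hy

/-- **The extrapolation estimate (two scales).**  On a compact body, for every order `n`,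
derivative order `γ` and radius `R` there is `C` such that: for `x` with `‖x - c‖ ≤ R` and
scales `0 < t' < t`, `2ⁿ t ≤ 1`, such that every ratio in `[1 - 2ⁿ t, 1 - t']` dilates `x` into
the interior of `K`,
`‖Dᵞ (approx f c n t) x - Dᵞ (approx f c n t') x‖ ≤ C tⁿ⁺¹`. [folklore] -/
theorem exists_extrapolation_bound (hf : ContDiffOn ℝ ∞ f K) (hKu : UniqueDiffOn ℝ K)
    (hKc : IsCompact K) (c : E) (γ n : ℕ) (R : ℝ) :
    ∃ C : ℝ, 0 ≤ C ∧ ∀ x : E, ‖x - c‖ ≤ R → ∀ t t' : ℝ, 0 < t' → t' < t → 2 ^ n * t ≤ 1 →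
      (∀ μ ∈ Icc (1 - 2 ^ n * t) (1 - t'), dil c μ x ∈ interior K) →
      ‖iteratedFDeriv ℝ γ (approx f c n t) x - iteratedFDeriv ℝ γ (approx f c n t') x‖ ≤
        C * t ^ (n + 1) := by
  obtain ⟨B, hB0, hB⟩ := exists_bound_iteratedFDeriv_lineJet hf hKu hKc c γ (n + 1) R
  have hW0 := weightMass_nonneg (n + 1)
  refine ⟨(weightMass (n + 1) + weightMass (n + 1)) * (B * (2 ^ n) ^ (n + 1) / n !),
    by positivity, fun x hxR t t' ht' htt' htn hseg => ?_⟩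
  have ht0 : 0 < t := ht'.trans htt'
  have h2n : (1 : ℝ) ≤ 2 ^ n := one_le_pow₀ (by norm_num)
  set a : ℝ := 1 - 2 ^ n * t with ha
  set b : ℝ := 1 - t' with hb
  have hab : a < b := by
    rw [ha, hb]; nlinarith
  have ha0 : 0 ≤ a := by rw [ha]; linarith
  have hb1 : b ≤ 1 := by rw [hb]; linarith
  have hsegR : Icc a b ⊆ raySet K c x := fun μ hμ => hseg μ hμ
  -- the nodes lie in `[a, b]`
  have hnode : ∀ j, j < n + 1 → dnode t j ∈ Icc a b := fun j hj =>
    ⟨by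
      have hj' : (2 : ℝ) ^ j * t ≤ 2 ^ n * t :=
        mul_le_mul_of_nonneg_right (pow_le_pow_right₀ (by norm_num) (by omega)) ht0.le
      rw [ha, dnode_apply]; linarith, (dnode_le j ht0.le).trans (by rw [hb]; linarith)⟩
  have hnode' : ∀ j, j < n + 1 → dnode t' j ∈ Icc a b := fun j hj =>
    ⟨(hnode j hj).1.trans (dnode_anti_scale j htt'.le), dnode_le j ht'.le⟩
  have hgood : x ∈ goodSet (interior K) c n t := fun j hj => hseg _ (hnode j hj)
  have hgood' : x ∈ goodSet (interior K) c n t' := fun j hj => hseg _ (hnode' j hj)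
  -- Taylor remainders at the nodes
  have hBμ : ∀ μ ∈ Icc a b, ‖iteratedFDeriv ℝ (n + 1) (lineJet f K c x γ) μ‖ ≤ B := fun μ hμ =>
    hB x hxR (n + 1) le_rfl μ ⟨ha0.trans hμ.1, hμ.2.trans hb1⟩ (hseg μ hμ)
  have hrem : ∀ μ ∈ Icc a b, ‖lineJet f K c x γ μ -
      taylorWithinEval (lineJet f K c x γ) n (Icc a b) a μ‖ ≤ B * (2 ^ n * t) ^ (n + 1) / n ! := by
    intro μ hμ
    refine (norm_lineJet_sub_taylor_le hf hKu c x γ n hab hsegR hBμ hμ).trans ?_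
    have h1 : μ - a ≤ 2 ^ n * t := by rw [ha]; linarith [hμ.2, ht'.le]
    have h2 : 0 ≤ μ - a := by linarith [hμ.1]
    gcongr
  rw [iteratedFDeriv_approx_eq_sum_lineJet hf hKu c n t hgood γ,
    iteratedFDeriv_approx_eq_sum_lineJet hf hKu c n t' hgood' γ]
  refine (norm_sum_weight_smul_sub_le (Nat.lt_succ_self n) (Nat.lt_succ_self n)
    (fun j hj => hrem _ (hnode j hj)) (fun j hj => hrem _ (hnode' j hj))).trans ?_
  rw [mul_pow]
  have : (weightMass (n + 1) + weightMass (n + 1)) * (B * ((2 ^ n) ^ (n + 1) * t ^ (n + 1)) / n !) =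
      (weightMass (n + 1) + weightMass (n + 1)) * (B * (2 ^ n) ^ (n + 1) / n !) * t ^ (n + 1) := by
    ring
  rw [this]

/-- **The extrapolation estimate (two orders).**  Same, at one scale `t` for the approximants
of orders `n` and `n + 1`: if every ratio in `[1 - 2ⁿ⁺¹ t, 1 - t]` dilates `x` into the
interior of `K` (and `2ⁿ⁺¹ t ≤ 1`), then
`‖Dᵞ (approx f c n t) x - Dᵞ (approx f c (n+1) t) x‖ ≤ C tⁿ⁺¹`. [folklore] -/
theorem exists_extrapolation_bound_succ (hf : ContDiffOn ℝ ∞ f K) (hKu : UniqueDiffOn ℝ K)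
    (hKc : IsCompact K) (c : E) (γ n : ℕ) (R : ℝ) :
    ∃ C : ℝ, 0 ≤ C ∧ ∀ x : E, ‖x - c‖ ≤ R → ∀ t : ℝ, 0 < t → 2 ^ (n + 1) * t ≤ 1 →
      (∀ μ ∈ Icc (1 - 2 ^ (n + 1) * t) (1 - t), dil c μ x ∈ interior K) →
      ‖iteratedFDeriv ℝ γ (approx f c n t) x - iteratedFDeriv ℝ γ (approx f c (n + 1) t) x‖ ≤
        C * t ^ (n + 1) := by
  obtain ⟨B, hB0, hB⟩ := exists_bound_iteratedFDeriv_lineJet hf hKu hKc c γ (n + 1) R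
  have hW0 := weightMass_nonneg (n + 1)
  have hW0' := weightMass_nonneg (n + 2)
  refine ⟨(weightMass (n + 1) + weightMass (n + 2)) * (B * (2 ^ (n + 1)) ^ (n + 1) / n !),
    by positivity, fun x hxR t ht0 htn hseg => ?_⟩
  have h2n : (1 : ℝ) ≤ 2 ^ n := one_le_pow₀ (by norm_num)
  set a : ℝ := 1 - 2 ^ (n + 1) * t with ha
  set b : ℝ := 1 - t with hb
  have hab : a < b := by
    rw [ha, hb, pow_succ]; nlinarith
  have ha0 : 0 ≤ a := by rw [ha]; linarith
  have hb1 : b ≤ 1 := by rw [hb]; linarith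
  have hsegR : Icc a b ⊆ raySet K c x := fun μ hμ => hseg μ hμ
  have hnode' : ∀ j, j < n + 2 → dnode t j ∈ Icc a b := fun j hj =>
    ⟨by
      have hj' : (2 : ℝ) ^ j * t ≤ 2 ^ (n + 1) * t :=
        mul_le_mul_of_nonneg_right (pow_le_pow_right₀ (by norm_num) (by omega)) ht0.le
      rw [ha, dnode_apply]; linarith, dnode_le j ht0.le⟩
  have hnode : ∀ j, j < n + 1 → dnode t j ∈ Icc a b := fun j hj => hnode' j (by omega)
  have hgood : x ∈ goodSet (interior K) c n t := fun j hj => hseg _ (hnode j hj)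
  have hgood' : x ∈ goodSet (interior K) c (n + 1) t := fun j hj => hseg _ (hnode' j hj)
  have hBμ : ∀ μ ∈ Icc a b, ‖iteratedFDeriv ℝ (n + 1) (lineJet f K c x γ) μ‖ ≤ B := fun μ hμ =>
    hB x hxR (n + 1) le_rfl μ ⟨ha0.trans hμ.1, hμ.2.trans hb1⟩ (hseg μ hμ)
  have hrem : ∀ μ ∈ Icc a b, ‖lineJet f K c x γ μ -
      taylorWithinEval (lineJet f K c x γ) n (Icc a b) a μ‖ ≤ B * (2 ^ (n + 1) * t) ^ (n + 1) / n ! := by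
    intro μ hμ
    refine (norm_lineJet_sub_taylor_le hf hKu c x γ n hab hsegR hBμ hμ).trans ?_
    have h1 : μ - a ≤ 2 ^ (n + 1) * t := by rw [ha]; linarith [hμ.2, ht0.le]
    have h2 : 0 ≤ μ - a := by linarith [hμ.1]
    gcongr
  rw [iteratedFDeriv_approx_eq_sum_lineJet hf hKu c n t hgood γ,
    iteratedFDeriv_approx_eq_sum_lineJet hf hKu c (n + 1) t hgood' γ]
  refine (norm_sum_weight_smul_sub_le (Nat.lt_succ_self n) (by omega : n < n + 2)
    (fun j hj => hrem _ (hnode j hj)) (fun j hj => hrem _ (hnode' j hj))).trans ?_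
  rw [mul_pow]
  have : (weightMass (n + 1) + weightMass (n + 2)) *
      (B * ((2 ^ (n + 1)) ^ (n + 1) * t ^ (n + 1)) / n !) =
      (weightMass (n + 1) + weightMass (n + 2)) * (B * (2 ^ (n + 1)) ^ (n + 1) / n !) * t ^ (n + 1) := by
    ring
  rw [this]

/-! ### The boundary estimate -/

/-- Bernoulli: `1 - μᵞ ≤ γ (1 - μ)` for `0 ≤ μ ≤ 1`. [folklore] -/
theorem one_sub_pow_le_mul {μ : ℝ} (hμ0 : 0 ≤ μ) (hμ1 : μ ≤ 1) (γ : ℕ) :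
    1 - μ ^ γ ≤ γ * (1 - μ) := by
  induction γ with
  | zero => simp
  | succ γ ih =>
    have hμγ : μ ^ γ ≤ 1 := pow_le_one₀ hμ0 hμ1
    have h : 1 - μ ^ (γ + 1) = (1 - μ ^ γ) + μ ^ γ * (1 - μ) := by ring
    rw [h, Nat.cast_succ, add_mul, one_mul]
    exact add_le_add ih (mul_le_of_le_one_left (by linarith) hμγ)

/-- **The boundary estimate.**  On a compact body, for every `ε > 0` (and orders `γ`, `n`,
radius `R`) there is `δ > 0` such that `‖Dᵞ (approx f c n t) x - Dᵞ_K f (b)‖ ≤ ε` whenever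
`‖x - c‖ ≤ R`, `b ∈ K`, `‖x - b‖ ≤ δ`, `0 ≤ t ≤ δ`, and the node dilates of `x` are interior
(uniform continuity of the jet on `K`; `∑ w_j = 1`; `1 - μᵞ ≤ γ (1 - μ)`). [folklore] -/
theorem exists_boundary_bound (hf : ContDiffOn ℝ ∞ f K) (hKu : UniqueDiffOn ℝ K)
    (hKc : IsCompact K) (c : E) (γ n : ℕ) (R : ℝ) {ε : ℝ} (hε : 0 < ε) :
    ∃ δ : ℝ, 0 < δ ∧ ∀ x : E, ‖x - c‖ ≤ R → ∀ b ∈ K, ‖x - b‖ ≤ δ → ∀ t : ℝ, 0 ≤ t → t ≤ δ →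
      x ∈ goodSet (interior K) c n t →
      ‖iteratedFDeriv ℝ γ (approx f c n t) x - iteratedFDerivWithin ℝ γ f K b‖ ≤ ε := by
  set p : E → E [×γ]→L[ℝ] F := iteratedFDerivWithin ℝ γ f K with hp
  -- a bound and a modulus of continuity for the jet on `K`
  obtain ⟨M, hM⟩ := hKc.exists_bound_of_continuousOn (continuousOn_jet hf hKu γ)
  set M' : ℝ := max M 0 with hM'
  have hM'0 : 0 ≤ M' := le_max_right _ _
  have hpM : ∀ z ∈ K, ‖p z‖ ≤ M' := fun z hz => (hM z hz).trans (le_max_left _ _)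
  set W : ℝ := weightMass (n + 1) with hW
  have hW1 : 1 ≤ W := one_le_weightMass (Nat.succ_pos n)
  have hW0 : 0 < W := zero_lt_one.trans_le hW1
  obtain ⟨δ₁, hδ₁, hUC⟩ := Metric.uniformContinuousOn_iff.1
    (hKc.uniformContinuousOn_of_continuous (continuousOn_jet hf hKu γ)) (ε / (2 * W)) (by positivity)
  set R' : ℝ := max R 0 with hR'
  have hR'0 : 0 ≤ R' := le_max_right _ _
  set A : ℝ := 1 + 2 ^ n * R' with hA
  have hA1 : 1 ≤ A := by
    have h0 : (0 : ℝ) ≤ 2 ^ n * R' := by positivity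
    rw [hA]; linarith
  set G : ℝ := γ * 2 ^ n * M' + 1 with hG
  have hG0 : 0 < G := by rw [hG]; positivity
  set δ : ℝ := min (min (δ₁ / (2 * A)) (ε / (2 * W * G))) (1 / 2 ^ n) with hδ
  have hδ0 : 0 < δ := by rw [hδ]; positivity
  have hδA : δ ≤ δ₁ / (2 * A) := (min_le_left _ _).trans (min_le_left _ _)
  have hδG : δ ≤ ε / (2 * W * G) := (min_le_left _ _).trans (min_le_right _ _)
  have hδn : δ ≤ 1 / 2 ^ n := min_le_right _ _
  refine ⟨δ, hδ0, fun x hxR b hb hxb t ht0 htδ hgood => ?_⟩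
  have h2n0 : (0 : ℝ) < 2 ^ n := by positivity
  have htn : 2 ^ n * t ≤ 1 := by
    calc 2 ^ n * t ≤ 2 ^ n * (1 / 2 ^ n) := mul_le_mul_of_nonneg_left (htδ.trans hδn) h2n0.le
      _ = 1 := by field_simp
  -- rewrite the difference as a weighted sum
  rw [iteratedFDeriv_approx_eq_sum_lineJet hf hKu c n t hgood γ]
  have hpb : p b = ∑ j ∈ range (n + 1), weight (n + 1) j • p b := by
    rw [← sum_smul, sum_weight (Nat.succ_pos n), one_smul]
  rw [hpb, ← sum_sub_distrib]
  simp_rw [← smul_sub]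
  -- termwise bound
  have hterm : ∀ j, j < n + 1 → ‖lineJet f K c x γ (dnode t j) - p b‖ ≤ ε / (2 * W) + γ * 2 ^ n * t * M' := by
    intro j hj
    set μ : ℝ := dnode t j with hμ
    have hμ1 : μ ≤ 1 := dnode_le_one j ht0
    have hμ0 : 0 ≤ μ := by
      have := le_dnode hj ht0
      simp only [Nat.add_sub_cancel] at this
      rw [hμ]; linarith
    have h1μ : 1 - μ ≤ 2 ^ n * t := by
      have := le_dnode hj ht0
      simp only [Nat.add_sub_cancel] at this
      rw [hμ]; linarith
    set z : E := dil c μ x with hz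
    have hzK : z ∈ K := interior_subset (hgood j hj)
    -- `z` is close to `b`
    have hzb : dist z b < δ₁ := by
      rw [dist_eq_norm]
      calc ‖z - b‖ ≤ ‖x - b‖ + (1 - μ) * ‖x - c‖ := norm_dil_sub_le c hμ1 x b
        _ ≤ δ + 2 ^ n * t * R' := by
            refine add_le_add hxb ?_
            exact mul_le_mul h1μ (hxR.trans (le_max_left _ _)) (norm_nonneg _) (by positivity)
        _ ≤ δ + 2 ^ n * δ * R' := by gcongr
        _ = δ * A := by rw [hA]; ring
        _ ≤ δ₁ / (2 * A) * A := mul_le_mul_of_nonneg_right hδA (by positivity)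
        _ = δ₁ / 2 := by field_simp
        _ < δ₁ := by linarith
    have hpz : ‖p z - p b‖ ≤ ε / (2 * W) := by
      have := hUC z hzK b hb hzb
      rw [dist_eq_norm] at this
      exact this.le
    -- split `μᵞ • p z - p b`
    have hsplit : lineJet f K c x γ μ - p b = μ ^ γ • (p z - p b) + (μ ^ γ - 1) • p b := by
      rw [lineJet_apply, smul_sub, sub_smul, one_smul]
      abel
    rw [hsplit]
    refine (norm_add_le _ _).trans (add_le_add ?_ ?_)
    · rw [norm_smul, Real.norm_of_nonneg (pow_nonneg hμ0 γ)]
      calc μ ^ γ * ‖p z - p b‖ ≤ 1 * (ε / (2 * W)) :=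
            mul_le_mul (pow_le_one₀ hμ0 hμ1) hpz (norm_nonneg _) zero_le_one
        _ = ε / (2 * W) := one_mul _
    · rw [norm_smul, Real.norm_eq_abs, abs_sub_comm, abs_of_nonneg (by
        have := pow_le_one₀ (n := γ) hμ0 hμ1; linarith)]
      calc (1 - μ ^ γ) * ‖p b‖ ≤ (γ * (1 - μ)) * M' :=
            mul_le_mul (one_sub_pow_le_mul hμ0 hμ1 γ) (hpM b hb) (norm_nonneg _) (by positivity)
        _ ≤ (γ * (2 ^ n * t)) * M' := by gcongr
        _ = γ * 2 ^ n * t * M' := by ring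
  refine (norm_sum_weight_smul_le _ hterm).trans ?_
  -- `W (ε/(2W) + γ 2ⁿ t M') ≤ ε`
  have h1 : W * (ε / (2 * W)) = ε / 2 := by field_simp
  have h2 : W * (γ * 2 ^ n * t * M') ≤ ε / 2 := by
    calc W * (γ * 2 ^ n * t * M') ≤ W * (γ * 2 ^ n * δ * M') := by gcongr
      _ ≤ W * (G * δ) := by
          refine mul_le_mul_of_nonneg_left ?_ hW0.le
          rw [hG]; nlinarith [hδ0, hM'0, (by positivity : (0:ℝ) ≤ γ * 2 ^ n * M')]
      _ ≤ W * (G * (ε / (2 * W * G))) := by gcongr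
      _ = ε / 2 := by field_simp
  calc W * (ε / (2 * W) + γ * 2 ^ n * t * M') = W * (ε / (2 * W)) + W * (γ * 2 ^ n * t * M') := by ring
    _ ≤ ε / 2 + ε / 2 := add_le_add h1.le h2
    _ = ε := by ring

end LineJet

end Literature.Analysis.Calculus.WhitneyConvex
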